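import Literature.Combinatorics.Sahi2008.UniformSquareAllOrders
import Literature.Combinatorics.Sahi2008.PushForward
import Literature.Probability.Percolation.TwoClusterConditionalSahi
import HarnessLib

/-!
# Lieb–Sahi (2022), Theorem 3.7 for EVERY product measure on a product of two finite chains

CITATION HEADER.  Source: E. H. Lieb, S. Sahi, *On the extension of the FKG inequality to `n` functions*,
J. Math. Phys. **63** (2022) 043301 = arXiv:2107.09838 [LiebSahi2021], Thm. 3.7: "If `f^1,…,f^n` are
positive and monotone on `[0,1]²` then `E_n(f^1,…,f^n) ≥ 0`" (Lebesgue measure), with §2 before Thm. 2.1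
(monotone changes of variables of `Q_k`) and Lemma 2.3 (discretisation and the limit
"`E_3(χ_S,χ_T,χ_U) = lim_{m→∞} E_3(χ_{S^m},χ_{T^m},χ_{U^m}) ≥ 0`"); read 2026-08-19 from the materialised text.

The tree has Thm. 3.7 in discrete form for the UNIFORM weight on the `m × m` grid and every `n`
(`Literature.Combinatorics.Sahi2008.LiebSahiGrid.sahiPositive_uniformGrid`, `UniformSquareAllOrders.lean`).
Every product probability measure `μ₁ × μ₂` on `[0,1]²` is the image of Lebesgue measure under the
coordinatewise monotone quantile maps, so Thm. 3.7 covers all product measures; this file proves the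
corresponding discrete statement: **for all finite chains `Fin a`, `Fin b` and ALL probability weights
`w₁`, `w₂` on them, the product weight `w₁ ⊗ w₂` on `Fin a × Fin b` is Sahi-positive of every order `n`.**
Route: a chain point of rational weight `k_i/M` is a block of `k_i` consecutive points of `Fin M`
(`blockMap`, monotone, fibres of size `k_i`), so `w₁ ⊗ w₂` with weights in `(1/M)ℕ` is the push-forward
of the uniform `M × M` grid along a monotone map (`pushWeight_gridWeight_blockMap₂`) and
`SahiPositive.of_pushWeight` applies; general weights by `⌊w_i M⌋/M → w_i` and the continuity of `E_n`
in the weight (`BHK2006.continuous_sahiE`), as in Lemma 2.3.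

## Contents (everything PROVED; no named fact)

* `cum`, `blockMap`, `blockMap_mono`, `card_blockMap_fibre` — the block map of a composition
  `k : Fin a → ℕ` of `M`.
* `pushWeight_gridWeight_blockMap₂` — the uniform `M × M` grid pushes forward to
  `(k₁ i/M)·(k₂ j/M)` on `Fin a × Fin b`.
* `sahiPositive_prodWeight_rat` — Sahi positivity of every order for product weights with a common
  denominator; **`sahiPositive_prodWeight`** — for ALL product probability weights on `Fin a × Fin b`;
  `sahiPositive_prodWeight_linearOrder` — on the product of any two finite nonempty linear orders.
-/

noncomputable section

namespace Literature.Combinatorics.Sahi2008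

namespace ProductChains

open Finset Filter Topology Function

/-! ### Lower sets of a finite chain are initial segments (plumbing) -/

/-- In `Fin m`, a lower set `Q` is the initial segment of length `#Q` (plumbing). [folklore] -/
private theorem mem_iff_lt_card_of_lower {m : ℕ} (Q : Finset (Fin m))
    (hQ : ∀ ⦃x y : Fin m⦄, y ≤ x → x ∈ Q → y ∈ Q) (q : Fin m) : q ∈ Q ↔ (q : ℕ) < Q.card := by
  constructor
  · intro hq
    have hsub : Finset.Iic q ⊆ Q := fun q' hq' => hQ (mem_Iic.1 hq') hq
    have := card_le_card hsub
    rw [Fin.card_Iic] at this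
    omega
  · intro hlt
    by_contra hq
    have hsub : Q ⊆ Finset.Iio q := by
      intro q' hq'
      rw [mem_Iio]
      by_contra hle
      exact hq (hQ (not_lt.1 hle) hq')
    have := card_le_card hsub
    rw [Fin.card_Iio] at this
    omega

/-- `#{t ∈ Fin M : lo ≤ t < hi} = hi − lo` for `hi ≤ M` (plumbing). [folklore] -/
private theorem card_filter_Ico_val {M lo hi : ℕ} (h : hi ≤ M) :
    (univ.filter fun t : Fin M => lo ≤ (t : ℕ) ∧ (t : ℕ) < hi).card = hi - lo := by
  have hmap : (univ.filter fun t : Fin M => lo ≤ (t : ℕ) ∧ (t : ℕ) < hi).map Fin.valEmbedding =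
      Finset.Ico lo hi := by
    ext x
    simp only [Finset.mem_map, Finset.mem_filter, Finset.mem_univ, true_and, Fin.valEmbedding_apply,
      Finset.mem_Ico]
    constructor
    · rintro ⟨t, ⟨hlo, hhi⟩, rfl⟩
      exact ⟨hlo, hhi⟩
    · rintro ⟨hlo, hhi⟩
      exact ⟨⟨x, lt_of_lt_of_le hhi h⟩, ⟨hlo, hhi⟩, rfl⟩
  rw [← card_map Fin.valEmbedding, hmap, Nat.card_Ico]

/-! ### Block maps -/

section Block

variable {a : ℕ}

/-- Cumulative counts `c_i = k_0 + ⋯ + k_i` of a composition `k`. [cite: LiebSahi2021, §2 (Lemma 2.3: blocks of little squares)] -/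
def cum (k : Fin a → ℕ) (i : Fin a) : ℕ := ∑ i' ∈ Iic i, k i'

/-- Counts strictly before `i`: `k_0 + ⋯ + k_{i−1}`. [cite: LiebSahi2021, §2 (Lemma 2.3)] -/
def cumLt (k : Fin a → ℕ) (i : Fin a) : ℕ := ∑ i' ∈ Iio i, k i'

/-- `c_i = (k_0 + ⋯ + k_{i−1}) + k_i`. [cite: LiebSahi2021, §2 (Lemma 2.3)] -/
theorem cum_eq (k : Fin a → ℕ) (i : Fin a) : cum k i = cumLt k i + k i := by
  rw [cum, cumLt, Iic_eq_cons_Iio, sum_cons, add_comm]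

/-- The cumulative counts are monotone. [cite: LiebSahi2021, §2 (Lemma 2.3)] -/
theorem cum_mono (k : Fin a → ℕ) : Monotone (cum k) := fun _ _ hij =>
  sum_le_sum_of_subset (Iic_subset_Iic.2 hij)

/-- `c_{i'} ≤ k_0 + ⋯ + k_{i−1}` for `i' < i`. [cite: LiebSahi2021, §2 (Lemma 2.3)] -/
theorem cum_le_cumLt (k : Fin a → ℕ) {i' i : Fin a} (h : i' < i) : cum k i' ≤ cumLt k i :=
  sum_le_sum_of_subset fun _ hx => mem_Iio.2 (lt_of_le_of_lt (mem_Iic.1 hx) h)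

/-- `c_i ≤ M = Σ k`. [cite: LiebSahi2021, §2 (Lemma 2.3)] -/
theorem cum_le_sum (k : Fin a → ℕ) (i : Fin a) : cum k i ≤ ∑ i', k i' :=
  sum_le_sum_of_subset (subset_univ _)

/-- The last cumulative count is the total. [cite: LiebSahi2021, §2 (Lemma 2.3)] -/
theorem cum_last (k : Fin (a + 1) → ℕ) : cum k (Fin.last a) = ∑ i, k i := by
  rw [cum]
  congr 1
  ext i
  simp only [mem_Iic, Fin.le_last, mem_univ]

/-- **The block map** of a composition `k` of `M = Σ k` into `a + 1` parts: `t ↦ #{i : c_i ≤ t}`, sending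
the `k_i` consecutive points `[c_{i−1}, c_i)` of `Fin M` to the chain point `i` (a chain point of weight
`k_i/M` as a block of little squares). [cite: LiebSahi2021, §2 (Lemma 2.3)] -/
def blockMap (k : Fin (a + 1) → ℕ) {M : ℕ} (hM : ∑ i, k i = M) (t : Fin M) : Fin (a + 1) :=
  ⟨(univ.filter fun i : Fin (a + 1) => cum k i ≤ (t : ℕ)).card, by
    have hsub : (univ.filter fun i : Fin (a + 1) => cum k i ≤ (t : ℕ)) ⊆ univ.erase (Fin.last a) := by
      intro i hi
      rw [mem_erase]
      refine ⟨fun h => ?_, mem_univ _⟩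
      rw [mem_filter] at hi
      rw [h, cum_last, hM] at hi
      exact absurd hi.2 (not_le.2 t.2)
    have := card_le_card hsub
    rw [card_erase_of_mem (mem_univ _), card_univ, Fintype.card_fin] at this
    omega⟩

/-- The block map is monotone. [cite: LiebSahi2021, §2 (Lemma 2.3)] -/
theorem blockMap_mono (k : Fin (a + 1) → ℕ) {M : ℕ} (hM : ∑ i, k i = M) : Monotone (blockMap k hM) := by
  intro t t' htt'
  refine Fin.mk_le_mk.2 (card_le_card fun i hi => ?_)
  simp only [mem_filter, mem_univ, true_and] at hi ⊢
  exact hi.trans htt'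

/-- `c_i ≤ t ↔ i < blockMap t` (the filter is an initial segment of the chain `Fin (a+1)`).
[cite: LiebSahi2021, §2 (Lemma 2.3)] -/
theorem cum_le_iff_lt_blockMap (k : Fin (a + 1) → ℕ) {M : ℕ} (hM : ∑ i, k i = M) (t : Fin M)
    (i : Fin (a + 1)) : cum k i ≤ (t : ℕ) ↔ (i : ℕ) < (blockMap k hM t : ℕ) := by
  have h := mem_iff_lt_card_of_lower (univ.filter fun i : Fin (a + 1) => cum k i ≤ (t : ℕ))
    (fun x y hyx hx => by
      simp only [mem_filter, mem_univ, true_and] at hx ⊢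
      exact (cum_mono k hyx).trans hx) i
  simp only [mem_filter, mem_univ, true_and] at h
  exact h

/-- **The fibres of the block map**: `blockMap t = i ↔ c_{i−1} ≤ t < c_i`.
[cite: LiebSahi2021, §2 (Lemma 2.3)] -/
theorem blockMap_eq_iff (k : Fin (a + 1) → ℕ) {M : ℕ} (hM : ∑ i, k i = M) (t : Fin M) (i : Fin (a + 1)) :
    blockMap k hM t = i ↔ cumLt k i ≤ (t : ℕ) ∧ (t : ℕ) < cum k i := by
  have hnot : ¬ cum k i ≤ (t : ℕ) ↔ (blockMap k hM t : ℕ) ≤ (i : ℕ) := by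
    rw [cum_le_iff_lt_blockMap, not_lt]
  constructor
  · intro h
    refine ⟨?_, not_le.1 (hnot.2 (by rw [h]))⟩
    rcases Nat.eq_zero_or_pos (i : ℕ) with hi0 | hipos
    · have : cumLt k i = 0 := by
        rw [cumLt]
        refine sum_eq_zero fun x hx => ?_
        have := Fin.lt_def.1 (mem_Iio.1 hx)
        omega
      omega
    · -- `i = j + 1`: `c_j ≤ t` since `j < blockMap t`
      have hlt : (i : ℕ) - 1 < a + 1 := by omega
      set j : Fin (a + 1) := ⟨(i : ℕ) - 1, hlt⟩ with hj
      have hjv : (j : ℕ) = (i : ℕ) - 1 := rfl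
      have hcj : cum k j ≤ (t : ℕ) := (cum_le_iff_lt_blockMap k hM t j).2 (by rw [h, hjv]; omega)
      have : cumLt k i ≤ cum k j := by
        rw [cumLt, cum]
        refine sum_le_sum_of_subset fun x hx => ?_
        rw [mem_Iio] at hx
        rw [mem_Iic]
        have hx' := Fin.lt_def.1 hx
        exact Fin.le_def.2 (by rw [hjv]; omega)
      omega
  · rintro ⟨hlo, hhi⟩
    apply Fin.ext
    apply le_antisymm
    · exact hnot.1 (not_le.2 hhi)
    · -- every `i' < i` has `c_{i'} ≤ cumLt i ≤ t`, so `i' < blockMap t`; hence `i ≤ blockMap t`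
      by_contra hlt
      rw [not_le] at hlt
      have hi' : (⟨(blockMap k hM t : ℕ), lt_trans hlt i.2⟩ : Fin (a + 1)) < i :=
        Fin.lt_def.2 hlt
      have h1 := (cum_le_cumLt k hi').trans hlo
      have h2 := (cum_le_iff_lt_blockMap k hM t _).1 h1
      exact absurd h2 (lt_irrefl _)

/-- **Each fibre of the block map has `k_i` points.** [cite: LiebSahi2021, §2 (Lemma 2.3)] -/
theorem card_blockMap_fibre (k : Fin (a + 1) → ℕ) {M : ℕ} (hM : ∑ i, k i = M) (i : Fin (a + 1)) :
    (univ.filter fun t : Fin M => blockMap k hM t = i).card = k i := by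
  have h : (univ.filter fun t : Fin M => blockMap k hM t = i) =
      univ.filter fun t : Fin M => cumLt k i ≤ (t : ℕ) ∧ (t : ℕ) < cum k i := by
    ext t
    simp only [mem_filter, mem_univ, true_and, blockMap_eq_iff]
  rw [h, card_filter_Ico_val ((cum_le_sum k i).trans hM.le), cum_eq]
  omega

end Block

/-! ### The uniform grid pushes forward to rational product weights -/

section Grid

open LiebSahiGrid (gridWeight sahiPositive_uniformGrid)

variable {a b : ℕ}

/-- The product block map `Fin M × Fin M → Fin (a+1) × Fin (b+1)`. [cite: LiebSahi2021, §2 (Lemma 2.3) and before Thm. 2.1 (coordinatewise changes of variables)] -/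
def blockMap₂ (k₁ : Fin (a + 1) → ℕ) (k₂ : Fin (b + 1) → ℕ) {M : ℕ} (h₁ : ∑ i, k₁ i = M)
    (h₂ : ∑ j, k₂ j = M) (p : Fin M × Fin M) : Fin (a + 1) × Fin (b + 1) :=
  (blockMap k₁ h₁ p.1, blockMap k₂ h₂ p.2)

/-- The product block map is monotone. [cite: LiebSahi2021, §2 (before Thm. 2.1)] -/
theorem blockMap₂_mono (k₁ : Fin (a + 1) → ℕ) (k₂ : Fin (b + 1) → ℕ) {M : ℕ} (h₁ : ∑ i, k₁ i = M)
    (h₂ : ∑ j, k₂ j = M) : Monotone (blockMap₂ k₁ k₂ h₁ h₂) := fun _ _ hpq =>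
  ⟨blockMap_mono k₁ h₁ hpq.1, blockMap_mono k₂ h₂ hpq.2⟩

/-- **The uniform `M × M` grid pushes forward to the product weight `(k₁ i/M)(k₂ j/M)`** along the
product block map. [cite: LiebSahi2021, Lemma 2.3 (§2)] -/
theorem pushWeight_gridWeight_blockMap₂ (k₁ : Fin (a + 1) → ℕ) (k₂ : Fin (b + 1) → ℕ) {M : ℕ}
    (h₁ : ∑ i, k₁ i = M) (h₂ : ∑ j, k₂ j = M) :
    pushWeight (gridWeight M) (blockMap₂ k₁ k₂ h₁ h₂) =
      fun p => ((k₁ p.1 : ℝ) / M) * ((k₂ p.2 : ℝ) / M) := by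
  classical
  funext p
  rw [pushWeight_apply]
  simp only [gridWeight]
  rw [show (∑ q : Fin M × Fin M, if blockMap₂ k₁ k₂ h₁ h₂ q = p then 1 / (M : ℝ) ^ 2 else 0) =
      1 / (M : ℝ) ^ 2 * ∑ q : Fin M × Fin M, if blockMap₂ k₁ k₂ h₁ h₂ q = p then (1 : ℝ) else 0 by
    rw [mul_sum]
    exact sum_congr rfl fun q _ => by split_ifs <;> simp]
  rw [sum_boole]
  have hfib : (univ.filter fun q : Fin M × Fin M => blockMap₂ k₁ k₂ h₁ h₂ q = p) =
      (univ.filter fun s : Fin M => blockMap k₁ h₁ s = p.1) ×ˢ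
        (univ.filter fun t : Fin M => blockMap k₂ h₂ t = p.2) := by
    ext q
    simp only [mem_filter, mem_univ, true_and, mem_product, blockMap₂, Prod.ext_iff]
  rw [hfib, card_product, card_blockMap_fibre, card_blockMap_fibre]
  push_cast
  ring

/-- **Sahi positivity of every order for RATIONAL product weights**: for compositions `k₁`, `k₂` of
`M ≥ 1`, the weight `(k₁ i/M)(k₂ j/M)` on `Fin (a+1) × Fin (b+1)` is Sahi-positive of every order `n`
(a monotone image of the uniform `M × M` grid, Lieb–Sahi Thm. 3.7 discrete).
[cite: LiebSahi2021, Thm. 3.7 and Lemma 2.3] -/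
theorem sahiPositive_prodWeight_rat (k₁ : Fin (a + 1) → ℕ) (k₂ : Fin (b + 1) → ℕ) {M : ℕ} (hM : 0 < M)
    (h₁ : ∑ i, k₁ i = M) (h₂ : ∑ j, k₂ j = M) (n : ℕ) :
    SahiPositive (fun p : Fin (a + 1) × Fin (b + 1) => ((k₁ p.1 : ℝ) / M) * ((k₂ p.2 : ℝ) / M)) n := by
  rw [← pushWeight_gridWeight_blockMap₂ k₁ k₂ h₁ h₂]
  exact (sahiPositive_uniformGrid hM n).of_pushWeight (blockMap₂_mono k₁ k₂ h₁ h₂)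

end Grid

/-! ### The limit: every product probability weight -/

section Limit

variable {a b : ℕ}

/-- The dyadic-free rational approximation of a probability weight on `Fin (a+1)`: `⌊w_i M⌋` for `i < a`
and the remainder at the last point. [cite: LiebSahi2021, Lemma 2.3 (discretisation)] -/
def approx (w : Fin (a + 1) → ℝ) (M : ℕ) (i : Fin (a + 1)) : ℕ :=
  if i = Fin.last a then M - ∑ i' ∈ univ.erase (Fin.last a), ⌊w i' * M⌋₊ else ⌊w i * M⌋₊

/-- The floors away from the last point do not exceed `M`. [cite: LiebSahi2021, Lemma 2.3] -/
theorem sum_floor_le (w : Fin (a + 1) → ℝ) (hw0 : ∀ i, 0 ≤ w i) (hw1 : ∑ i, w i = 1) (M : ℕ) :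
    ∑ i' ∈ univ.erase (Fin.last a), ⌊w i' * M⌋₊ ≤ M := by
  have h : ((∑ i' ∈ univ.erase (Fin.last a), ⌊w i' * M⌋₊ : ℕ) : ℝ) ≤ M := by
    push_cast
    calc ∑ i' ∈ univ.erase (Fin.last a), (⌊w i' * (M : ℝ)⌋₊ : ℝ)
        ≤ ∑ i' ∈ univ.erase (Fin.last a), w i' * M :=
          sum_le_sum fun i _ => Nat.floor_le (mul_nonneg (hw0 i) (Nat.cast_nonneg M))
      _ ≤ ∑ i', w i' * M :=
          sum_le_sum_of_subset_of_nonneg (erase_subset _ _) fun i _ _ =>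
            mul_nonneg (hw0 i) (Nat.cast_nonneg M)
      _ = M := by rw [← sum_mul, hw1, one_mul]
  exact_mod_cast h

/-- The approximation is a composition of `M`. [cite: LiebSahi2021, Lemma 2.3] -/
theorem sum_approx (w : Fin (a + 1) → ℝ) (hw0 : ∀ i, 0 ≤ w i) (hw1 : ∑ i, w i = 1) (M : ℕ) :
    ∑ i, approx w M i = M := by
  rw [← Finset.sum_erase_add _ _ (mem_univ (Fin.last a))]
  have h1 : ∑ i ∈ univ.erase (Fin.last a), approx w M i = ∑ i ∈ univ.erase (Fin.last a), ⌊w i * M⌋₊ :=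
    sum_congr rfl fun i hi => by rw [approx, if_neg (ne_of_mem_erase hi)]
  rw [h1, approx, if_pos rfl]
  have := sum_floor_le w hw0 hw1 M
  omega

/-- The approximation converges: `approx w M i / M → w i`. [cite: LiebSahi2021, Lemma 2.3 (the limit `m → ∞`)] -/
theorem tendsto_approx_div (w : Fin (a + 1) → ℝ) (hw0 : ∀ i, 0 ≤ w i) (hw1 : ∑ i, w i = 1)
    (i : Fin (a + 1)) :
    Tendsto (fun M : ℕ => (approx w M i : ℝ) / M) atTop (𝓝 (w i)) := by
  have hfloor : ∀ i', Tendsto (fun M : ℕ => (⌊w i' * (M : ℝ)⌋₊ : ℝ) / M) atTop (𝓝 (w i')) := fun i' =>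
    (tendsto_nat_floor_mul_div_atTop (hw0 i')).comp tendsto_natCast_atTop_atTop
  by_cases hi : i = Fin.last a
  · subst hi
    -- the remainder: `1 − Σ_{i' ≠ last} ⌊w_{i'} M⌋/M → 1 − Σ_{i' ≠ last} w_{i'} = w_last`
    have hlast : w (Fin.last a) = 1 - ∑ i' ∈ univ.erase (Fin.last a), w i' := by
      rw [← hw1, ← Finset.sum_erase_add _ _ (mem_univ (Fin.last a))]
      ring
    rw [hlast]
    have hlim : Tendsto (fun M : ℕ => (1 : ℝ) - ∑ i' ∈ univ.erase (Fin.last a), (⌊w i' * (M : ℝ)⌋₊ : ℝ) / M)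
        atTop (𝓝 (1 - ∑ i' ∈ univ.erase (Fin.last a), w i')) :=
      tendsto_const_nhds.sub (tendsto_finsetSum _ fun i' _ => hfloor i')
    refine hlim.congr' ?_
    filter_upwards [eventually_ge_atTop 1] with M hM
    have hMne : (M : ℝ) ≠ 0 := by exact_mod_cast (Nat.one_le_iff_ne_zero.1 hM)
    rw [approx, if_pos rfl, Nat.cast_sub (sum_floor_le w hw0 hw1 M)]
    push_cast
    rw [sub_div, div_self hMne, sum_div]
  · have h : (fun M : ℕ => (approx w M i : ℝ) / M) = fun M : ℕ => (⌊w i * (M : ℝ)⌋₊ : ℝ) / M := by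
      funext M
      rw [approx, if_neg hi]
    rw [h]
    exact hfloor i

/-- The product weight is continuous in the two marginal weights. [cite: LiebSahi2021, Lemma 2.3 (the limit step)] -/
theorem continuous_prodWeight :
    Continuous fun v : (Fin (a + 1) → ℝ) × (Fin (b + 1) → ℝ) =>
      fun p : Fin (a + 1) × Fin (b + 1) => v.1 p.1 * v.2 p.2 :=
  continuous_pi fun p =>
    ((continuous_apply p.1).comp continuous_fst).mul ((continuous_apply p.2).comp continuous_snd)

/-- **Lieb–Sahi's Theorem 3.7 for every product measure, discrete form**: for ALL probability weights
`w₁` on `Fin (a+1)` and `w₂` on `Fin (b+1)`, the product weight `w₁ ⊗ w₂` on the product of the two chains is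
Sahi-positive of EVERY order `n`: `E_n(f_1,…,f_n) ≥ 0` for all nonnegative monotone `f_i`.  (Rational
weights: a monotone image of the uniform grid; in general: the limit `⌊w M⌋/M → w` with `E_n` continuous
in the weight.) [cite: LiebSahi2021, Thm. 3.7 with Lemma 2.3 and the change of variables of §2] -/
theorem sahiPositive_prodWeight (w₁ : Fin (a + 1) → ℝ) (w₂ : Fin (b + 1) → ℝ) (h₁0 : ∀ i, 0 ≤ w₁ i)
    (h₁1 : ∑ i, w₁ i = 1) (h₂0 : ∀ j, 0 ≤ w₂ j) (h₂1 : ∑ j, w₂ j = 1) (n : ℕ) :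
    SahiPositive (fun p : Fin (a + 1) × Fin (b + 1) => w₁ p.1 * w₂ p.2) n := by
  intro f hf hmono
  -- the map weights ↦ E_n is continuous
  have hcont : Continuous fun v : (Fin (a + 1) → ℝ) × (Fin (b + 1) → ℝ) =>
      sahiE (fun p : Fin (a + 1) × Fin (b + 1) => v.1 p.1 * v.2 p.2) n f :=
    (Literature.Probability.Percolation.BHK2006.continuous_sahiE n f).comp continuous_prodWeight
  -- the approximating rational weights converge
  have hlim : Tendsto (fun M : ℕ => ((fun i => (approx w₁ M i : ℝ) / M), (fun j => (approx w₂ M j : ℝ) / M)))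
      atTop (𝓝 (w₁, w₂)) :=
    (tendsto_pi_nhds.2 (tendsto_approx_div w₁ h₁0 h₁1)).prodMk_nhds
      (tendsto_pi_nhds.2 (tendsto_approx_div w₂ h₂0 h₂1))
  refine ge_of_tendsto ((hcont.tendsto (w₁, w₂)).comp hlim) ?_
  filter_upwards [eventually_ge_atTop 1] with M hM
  exact sahiPositive_prodWeight_rat (approx w₁ M) (approx w₂ M) hM (sum_approx w₁ h₁0 h₁1 M)
    (sum_approx w₂ h₂0 h₂1 M) n f hf hmono

/-- **The same on the product of any two finite nonempty chains** `α × β` (linear orders), for any two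
probability weights. [cite: LiebSahi2021, Thm. 3.7 with Lemma 2.3 and the change of variables of §2] -/
theorem sahiPositive_prodWeight_linearOrder {α β : Type*} [LinearOrder α] [Fintype α] [Nonempty α]
    [LinearOrder β] [Fintype β] [Nonempty β] (w₁ : α → ℝ) (w₂ : β → ℝ) (h₁0 : ∀ x, 0 ≤ w₁ x)
    (h₁1 : ∑ x, w₁ x = 1) (h₂0 : ∀ y, 0 ≤ w₂ y) (h₂1 : ∑ y, w₂ y = 1) (n : ℕ) :
    SahiPositive (fun p : α × β => w₁ p.1 * w₂ p.2) n := by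
  obtain ⟨a, ha⟩ : ∃ a, Fintype.card α = a + 1 :=
    Nat.exists_eq_succ_of_ne_zero Fintype.card_ne_zero
  obtain ⟨b, hb⟩ : ∃ b, Fintype.card β = b + 1 :=
    Nat.exists_eq_succ_of_ne_zero Fintype.card_ne_zero
  set e₁ : Fin (a + 1) ≃o α := Fintype.orderIsoFinOfCardEq α ha
  set e₂ : Fin (b + 1) ≃o β := Fintype.orderIsoFinOfCardEq β hb
  set e : Fin (a + 1) × Fin (b + 1) ≃ α × β := e₁.toEquiv.prodCongr e₂.toEquiv with he
  have hmono : Monotone e := fun p q hpq => ⟨e₁.monotone hpq.1, e₂.monotone hpq.2⟩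
  have hw : pushWeight (fun p : Fin (a + 1) × Fin (b + 1) => w₁ (e₁ p.1) * w₂ (e₂ p.2)) e =
      fun p : α × β => w₁ p.1 * w₂ p.2 := by
    funext p
    rw [pushWeight_equiv]
    simp [he]
  rw [← hw]
  refine SahiPositive.of_pushWeight ?_ hmono
  have h₁1' : ∑ i, w₁ (e₁ i) = 1 := by rw [← h₁1]; exact e₁.toEquiv.sum_comp w₁
  have h₂1' : ∑ j, w₂ (e₂ j) = 1 := by rw [← h₂1]; exact e₂.toEquiv.sum_comp w₂
  exact sahiPositive_prodWeight (fun i => w₁ (e₁ i)) (fun j => w₂ (e₂ j)) (fun i => h₁0 _) h₁1'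
    (fun j => h₂0 _) h₂1' n

end Limit

end ProductChains

end Literature.Combinatorics.Sahi2008
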